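import Summits.Schanuel.Schanuel.Theorems.ZilberEacParamFibreCurveGrowthTilt
import HarnessLib

/-!
# Polynomially parametrised base curves, XLIX: growth of `Re (c R^e + D)` when `Re R(t_j) → L₀`
# — the HORIZONTAL EDGE below the Puiseux gap (the equimodular functional)

HONEST FRAMING.  Cell `pub-schanuel` (Zilber's EAC, case ladder; host summit Schanuel), seat 2,
gen 21.  Companion of file XLII.  `deg R = d ≥ 2`, `a = lc(R)`, `e = k+2`, `Re(c i^e) = 0`,
`deg D ≤ d(k+1)`, `D_top = D_{d(k+1)}`; `‖t_j‖ → ∞`, `Re R(t_j) → L₀` (file XLVIII, `L₀ = log ‖θ‖`).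
If `Λ = (k+2) Re(c i^{k+1}) L₀ + Re(D_top i^{k+1}/a^{k+1}) ≠ 0` then `|Re G|/log(2 + ‖G‖) → ∞`
along `t_j`, `G = c R^e + D` (`tendsto_growth_eval_of_flat`):
`Re G = (Im w)^{k+1} (Λ + o(1)) + O(‖t‖^{d(k+1)-1})` with `w = R(t_j)`.  `Λ = 0` is ONE value of `log ‖θ‖`: the equimodular circle, as over graph bases
(gen 18).  Mantova–Masser's question is OPEN (PLMS 2024 §1 p. 5); NOT Schanuel's conjecture
(EAC ⇏ SC); `EC(3,2)` stays OPEN.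
-/

noncomputable section

open Filter Topology Metric Set Complex Polynomial
open Literature.ModelTheory.Zilber
open Literature.Geometry.Symplectic.RotationBranch (norm_pow_sub_pow_le)

set_option linter.dupNamespace false

namespace Summit.Schanuel.Schanuel.Theorems

/-- Removing the coefficient of `X^N` from a polynomial of degree `≤ N` leaves degree `≤ N - 1`. -/
theorem natDegree_sub_C_mul_X_pow_le (D : Polynomial ℂ) {N : ℕ} (hD : D.natDegree ≤ N) :
    (D - Polynomial.C (D.coeff N) * Polynomial.X ^ N).natDegree ≤ N - 1 := by
  refine (Polynomial.natDegree_le_iff_coeff_eq_zero).2 fun i hi => ?_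
  have hiN : N ≤ i := by omega
  rw [Polynomial.coeff_sub, Polynomial.coeff_C_mul, Polynomial.coeff_X_pow]
  rcases hiN.eq_or_lt with h | h
  · subst h; simp
  · rw [if_neg (Nat.ne_of_gt h), mul_zero, sub_zero]
    exact Polynomial.coeff_eq_zero_of_natDegree_lt (lt_of_le_of_lt hD h)

/-- `‖w^{k+1} - (i Im w)^{k+1}‖ ≤ (k+1) ‖w‖^k |Re w|`. -/
theorem norm_pow_sub_imPow_le (w : ℂ) (k : ℕ) :
    ‖w ^ (k + 1) - ((w.im : ℂ) * I) ^ (k + 1)‖ ≤ ((k + 1 : ℕ) : ℝ) * ‖w‖ ^ k * |w.re| := by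
  set w' : ℂ := (w.im : ℂ) * I with hw'_def
  have hnw' : ‖w'‖ ≤ ‖w‖ := by
    rw [hw'_def, norm_mul, Complex.norm_I, mul_one, Complex.norm_real, Real.norm_eq_abs]
    exact Complex.abs_im_le_norm w
  have hdiff : w - w' = (w.re : ℂ) := by apply Complex.ext <;> simp [hw'_def]
  have h := norm_pow_sub_pow_le (le_refl ‖w‖) hnw' (k + 1)
  rw [hdiff, Complex.norm_real, Real.norm_eq_abs, Nat.add_sub_cancel] at h
  exact_mod_cast h

/-- **The `D`-part along a horizontal edge.**  `deg R = d ≥ 1`, `a = lc(R)`, `N₁ = d(k+1)`,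
`deg D ≤ N₁`, `w = R(t)`, `|Re w| ≤ X₀`, `‖t‖ ≥ 1`:
`|Re D(t) - Re(D_{N₁} i^{k+1}/a^{k+1}) (Im w)^{k+1}| ≤ K_D ‖t‖^{N₁-1}` (`a t^d = w - ℓ(t)`,
`w^{k+1} = (i Im w)^{k+1} + O(‖w‖^k |Re w|)`). (new) -/
theorem flat_D_re_estimate (R : Polynomial ℂ) (hd : 1 ≤ R.natDegree) (D : Polynomial ℂ) {k : ℕ}
    (hD : D.natDegree ≤ R.natDegree * (k + 1)) {X₀ : ℝ} {t : ℂ} (h1 : 1 ≤ ‖t‖)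
    (hx : |(R.eval t).re| ≤ X₀) :
    |(D.eval t).re - (D.coeff (R.natDegree * (k + 1)) * I ^ (k + 1) /
        R.leadingCoeff ^ (k + 1)).re * (R.eval t).im ^ (k + 1)| ≤
      (coeffNormSum (D - Polynomial.C (D.coeff (R.natDegree * (k + 1))) *
          Polynomial.X ^ (R.natDegree * (k + 1))) +
        ‖D.coeff (R.natDegree * (k + 1))‖ / ‖R.leadingCoeff‖ ^ (k + 1) *
          (((k + 1 : ℕ) : ℝ) * (‖R.leadingCoeff‖ + coeffNormSum R) ^ k * coeffNormSum R.eraseLead +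
            ((k + 1 : ℕ) : ℝ) * coeffNormSum R ^ k * X₀)) *
        ‖t‖ ^ (R.natDegree * (k + 1) - 1) := by
  set d : ℕ := R.natDegree with hd_def
  have hR0 : R ≠ 0 := by rintro rfl; rw [hd_def, Polynomial.natDegree_zero] at hd; omega
  obtain ⟨a, ha_def⟩ : ∃ a : ℂ, a = R.leadingCoeff := ⟨_, rfl⟩
  rw [← ha_def]
  have ha0 : a ≠ 0 := by rw [ha_def]; exact Polynomial.leadingCoeff_ne_zero.2 hR0
  have hapos : 0 < ‖a‖ := norm_pos_iff.2 ha0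
  obtain ⟨Cℓ, hCℓ⟩ : ∃ Cℓ : ℝ, Cℓ = coeffNormSum R.eraseLead := ⟨_, rfl⟩
  have hCℓ0 : 0 ≤ Cℓ := by rw [hCℓ]; exact coeffNormSum_nonneg _
  obtain ⟨CR, hCR⟩ : ∃ CR : ℝ, CR = coeffNormSum R := ⟨_, rfl⟩
  have hCR0 : 0 ≤ CR := by rw [hCR]; exact coeffNormSum_nonneg _
  obtain ⟨N₁, hN₁⟩ : ∃ N₁ : ℕ, N₁ = d * (k + 1) := ⟨_, rfl⟩
  rw [← hN₁] at hD ⊢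
  obtain ⟨Dt, hDt⟩ : ∃ Dt : ℂ, Dt = D.coeff N₁ := ⟨_, rfl⟩
  obtain ⟨Dl, hDl⟩ : ∃ Dl : Polynomial ℂ, Dl = D - Polynomial.C Dt * Polynomial.X ^ N₁ := ⟨_, rfl⟩
  rw [← hDt, ← hDl, ← hCℓ, ← hCR]
  have hDldeg : Dl.natDegree ≤ N₁ - 1 := by rw [hDl, hDt]; exact natDegree_sub_C_mul_X_pow_le D hD
  set s : ℝ := ‖t‖ with hs_def
  have hs0 : 0 < s := by linarith
  have hN₁' : N₁ = d * k + d := by rw [hN₁]; ring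
  have hdk : d * k ≤ N₁ - 1 := by omega
  obtain ⟨w, hw_def⟩ : ∃ w : ℂ, w = R.eval t := ⟨_, rfl⟩
  rw [← hw_def] at hx ⊢
  set x : ℝ := w.re with hx_def
  set y : ℝ := w.im with hy_def
  obtain ⟨β, hβ⟩ : ∃ β : ℝ, β = (Dt * I ^ (k + 1) / a ^ (k + 1)).re := ⟨_, rfl⟩
  rw [← hβ]
  have hwup : ‖w‖ ≤ CR * s ^ d := by
    rw [hw_def, hCR]; exact norm_eval_le_of_natDegree_le R h1 le_rfl le_rfl
  have hwk : ‖w‖ ^ k ≤ CR ^ k * s ^ (N₁ - 1) := by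
    calc ‖w‖ ^ k ≤ (CR * s ^ d) ^ k := pow_le_pow_left₀ (norm_nonneg _) hwup k
      _ = CR ^ k * s ^ (d * k) := by rw [mul_pow, ← pow_mul]
      _ ≤ CR ^ k * s ^ (N₁ - 1) :=
          mul_le_mul_of_nonneg_left (pow_le_pow_right₀ h1 hdk) (by positivity)
  have hDdec : D.eval t = Dt * t ^ N₁ + Dl.eval t := by
    rw [hDl, Polynomial.eval_sub, Polynomial.eval_mul, Polynomial.eval_C, Polynomial.eval_pow,
      Polynomial.eval_X]; ring
  have hE2 : ‖Dl.eval t‖ ≤ coeffNormSum Dl * s ^ (N₁ - 1) :=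
    norm_eval_le_of_natDegree_le Dl h1 le_rfl hDldeg
  have hatd : a * t ^ d = w - R.eraseLead.eval t := by
    rw [hw_def, eval_eq_eraseLead_add R t, ← ha_def]; ring
  have hℓ : ‖R.eraseLead.eval t‖ ≤ Cℓ * s ^ (d - 1) := by
    rw [hCℓ]
    exact norm_eval_le_of_natDegree_le R.eraseLead h1 le_rfl
      (by have := Polynomial.eraseLead_natDegree_le R; omega)
  have hE3 : ‖(a * t ^ d) ^ (k + 1) - w ^ (k + 1)‖ ≤
      ((k + 1 : ℕ) : ℝ) * (‖a‖ + CR) ^ k * Cℓ * s ^ (N₁ - 1) := by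
    have hsdpos : 0 ≤ s ^ d := pow_nonneg hs0.le d
    have hM1 : ‖a * t ^ d‖ ≤ (‖a‖ + CR) * s ^ d := by
      rw [norm_mul, norm_pow, add_mul]
      linarith [mul_nonneg hCR0 hsdpos]
    have hM2 : ‖w‖ ≤ (‖a‖ + CR) * s ^ d := by
      rw [add_mul]; linarith [mul_nonneg hapos.le hsdpos]
    have h := norm_pow_sub_pow_le hM1 hM2 (k + 1)
    rw [Nat.add_sub_cancel] at h
    refine h.trans ?_
    rw [hatd, sub_sub_cancel_left, norm_neg]
    have hsdk : ((‖a‖ + CR) * s ^ d) ^ k * (Cℓ * s ^ (d - 1)) =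
        (‖a‖ + CR) ^ k * Cℓ * s ^ (d * k + (d - 1)) := by
      rw [mul_pow, ← pow_mul, pow_add]; ring
    have hexp : d * k + (d - 1) = N₁ - 1 := by omega
    calc ((k + 1 : ℕ) : ℝ) * ((‖a‖ + CR) * s ^ d) ^ k * ‖R.eraseLead.eval t‖
        ≤ ((k + 1 : ℕ) : ℝ) * ((‖a‖ + CR) * s ^ d) ^ k * (Cℓ * s ^ (d - 1)) :=
          mul_le_mul_of_nonneg_left hℓ (by positivity)
      _ = ((k + 1 : ℕ) : ℝ) * (‖a‖ + CR) ^ k * Cℓ * s ^ (N₁ - 1) := by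
          rw [mul_assoc (((k + 1 : ℕ) : ℝ)), hsdk, hexp]; ring
  have hE4 : ‖w ^ (k + 1) - ((y : ℂ) * I) ^ (k + 1)‖ ≤
      ((k + 1 : ℕ) : ℝ) * CR ^ k * X₀ * s ^ (N₁ - 1) := by
    refine (norm_pow_sub_imPow_le w k).trans ?_
    rw [← hx_def]
    calc ((k + 1 : ℕ) : ℝ) * ‖w‖ ^ k * |x| ≤ ((k + 1 : ℕ) : ℝ) * (CR ^ k * s ^ (N₁ - 1)) * X₀ := by
          gcongr
      _ = ((k + 1 : ℕ) : ℝ) * CR ^ k * X₀ * s ^ (N₁ - 1) := by ring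
  have hak : a ^ (k + 1) ≠ 0 := pow_ne_zero _ ha0
  have htN : (a * t ^ d) ^ (k + 1) = a ^ (k + 1) * t ^ N₁ := by rw [mul_pow, ← pow_mul, ← hN₁]
  have htN' : Dt * t ^ N₁ = Dt / a ^ (k + 1) * (a * t ^ d) ^ (k + 1) := by
    rw [htN, ← mul_assoc, div_mul_cancel₀ _ hak]
  have hreiy : (Dt * ((y : ℂ) * I) ^ (k + 1) / a ^ (k + 1)).re = β * y ^ (k + 1) := by
    rw [hβ, show Dt * ((y : ℂ) * I) ^ (k + 1) / a ^ (k + 1) =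
      ((y ^ (k + 1) : ℝ) : ℂ) * (Dt * I ^ (k + 1) / a ^ (k + 1)) by rw [mul_pow]; push_cast; ring,
      Complex.re_ofReal_mul, mul_comm]
  have hE34 : |(Dt * t ^ N₁).re - β * y ^ (k + 1)| ≤
      ‖Dt‖ / ‖a‖ ^ (k + 1) * (((k + 1 : ℕ) : ℝ) * (‖a‖ + CR) ^ k * Cℓ +
        ((k + 1 : ℕ) : ℝ) * CR ^ k * X₀) * s ^ (N₁ - 1) := by
    rw [← hreiy, ← Complex.sub_re, htN']
    refine (Complex.abs_re_le_norm _).trans ?_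
    rw [show Dt / a ^ (k + 1) * (a * t ^ d) ^ (k + 1) - Dt * ((y : ℂ) * I) ^ (k + 1) / a ^ (k + 1) =
      Dt / a ^ (k + 1) * (((a * t ^ d) ^ (k + 1) - w ^ (k + 1)) +
        (w ^ (k + 1) - ((y : ℂ) * I) ^ (k + 1))) by ring, norm_mul, norm_div, norm_pow]
    have hsum : ‖((a * t ^ d) ^ (k + 1) - w ^ (k + 1)) + (w ^ (k + 1) - ((y : ℂ) * I) ^ (k + 1))‖ ≤
        (((k + 1 : ℕ) : ℝ) * (‖a‖ + CR) ^ k * Cℓ + ((k + 1 : ℕ) : ℝ) * CR ^ k * X₀) *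
          s ^ (N₁ - 1) := by
      refine (norm_add_le _ _).trans ?_
      calc ‖(a * t ^ d) ^ (k + 1) - w ^ (k + 1)‖ + ‖w ^ (k + 1) - ((y : ℂ) * I) ^ (k + 1)‖
          ≤ ((k + 1 : ℕ) : ℝ) * (‖a‖ + CR) ^ k * Cℓ * s ^ (N₁ - 1) +
            ((k + 1 : ℕ) : ℝ) * CR ^ k * X₀ * s ^ (N₁ - 1) := add_le_add hE3 hE4
        _ = (((k + 1 : ℕ) : ℝ) * (‖a‖ + CR) ^ k * Cℓ + ((k + 1 : ℕ) : ℝ) * CR ^ k * X₀) *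
            s ^ (N₁ - 1) := by ring
    rw [mul_assoc]
    exact mul_le_mul_of_nonneg_left hsum (by positivity)
  rw [hDdec, Complex.add_re]
  have e : (Dt * t ^ N₁).re + (Dl.eval t).re - β * y ^ (k + 1) =
      ((Dt * t ^ N₁).re - β * y ^ (k + 1)) + (Dl.eval t).re := by ring
  rw [e]
  have hDl' : |(Dl.eval t).re| ≤ coeffNormSum Dl * s ^ (N₁ - 1) :=
    (Complex.abs_re_le_norm _).trans hE2
  calc |((Dt * t ^ N₁).re - β * y ^ (k + 1)) + (Dl.eval t).re|
      ≤ |(Dt * t ^ N₁).re - β * y ^ (k + 1)| + |(Dl.eval t).re| := abs_add_le _ _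
    _ ≤ ‖Dt‖ / ‖a‖ ^ (k + 1) * (((k + 1 : ℕ) : ℝ) * (‖a‖ + CR) ^ k * Cℓ +
          ((k + 1 : ℕ) : ℝ) * CR ^ k * X₀) * s ^ (N₁ - 1) + coeffNormSum Dl * s ^ (N₁ - 1) :=
        add_le_add hE34 hDl'
    _ = _ := by ring

/-- **Pointwise lower bound along a horizontal edge.**  See `tendsto_growth_eval_of_flat`. (new) -/
theorem flat_re_lower_bound (R : Polynomial ℂ) (hd : 2 ≤ R.natDegree) (c : ℂ) {k : ℕ}
    (hph : (c * I ^ (k + 2)).re = 0) (D : Polynomial ℂ) (hD : D.natDegree ≤ R.natDegree * (k + 1))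
    {X₀ η : ℝ} (hX₀ : 0 ≤ X₀) (hη : 0 < η) {t : ℂ} (hx : |(R.eval t).re| ≤ X₀)
    (hΛ : η ≤ |((k + 2 : ℕ) : ℝ) * (c * I ^ (k + 1)).re * (R.eval t).re +
      (D.coeff (R.natDegree * (k + 1)) * I ^ (k + 1) / R.leadingCoeff ^ (k + 1)).re|)
    (h1 : 1 ≤ ‖t‖) (h2 : 2 * coeffNormSum R.eraseLead ≤ ‖R.leadingCoeff‖ * ‖t‖)
    (h3 : 4 * X₀ ≤ ‖R.leadingCoeff‖ * ‖t‖)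
    {K₀ : ℝ} (hK₀ : K₀ = ‖c‖ * ((k + 2 : ℕ) : ℝ) ^ 2 * coeffNormSum R ^ k * X₀ ^ 2 +
      (coeffNormSum (D - Polynomial.C (D.coeff (R.natDegree * (k + 1))) *
        Polynomial.X ^ (R.natDegree * (k + 1))) +
      ‖D.coeff (R.natDegree * (k + 1))‖ / ‖R.leadingCoeff‖ ^ (k + 1) *
        (((k + 1 : ℕ) : ℝ) * (‖R.leadingCoeff‖ + coeffNormSum R) ^ k * coeffNormSum R.eraseLead +
          ((k + 1 : ℕ) : ℝ) * coeffNormSum R ^ k * X₀)))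
    (h4 : K₀ ≤ η / 2 * (‖R.leadingCoeff‖ / 4) ^ (k + 1) * ‖t‖) :
    η / 2 * (‖R.leadingCoeff‖ / 4) ^ (k + 1) * ‖t‖ ^ (R.natDegree * (k + 1)) ≤
      |((Polynomial.C c * R ^ (k + 2) + D).eval t).re| := by
  have hDest := flat_D_re_estimate R (by omega) D hD h1 hx
  set d : ℕ := R.natDegree with hd_def
  have hR0 : R ≠ 0 := by rintro rfl; rw [hd_def, Polynomial.natDegree_zero] at hd; omega
  obtain ⟨a, ha_def⟩ : ∃ a : ℂ, a = R.leadingCoeff := ⟨_, rfl⟩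
  rw [← ha_def] at hΛ h2 h3 hK₀ h4 hDest ⊢
  have ha0 : a ≠ 0 := by rw [ha_def]; exact Polynomial.leadingCoeff_ne_zero.2 hR0
  have hapos : 0 < ‖a‖ := norm_pos_iff.2 ha0
  obtain ⟨CR, hCR⟩ : ∃ CR : ℝ, CR = coeffNormSum R := ⟨_, rfl⟩
  have hCR0 : 0 ≤ CR := by rw [hCR]; exact coeffNormSum_nonneg _
  obtain ⟨KD, hKD⟩ : ∃ KD : ℝ, KD = coeffNormSum (D - Polynomial.C (D.coeff (d * (k + 1))) *
      Polynomial.X ^ (d * (k + 1))) + ‖D.coeff (d * (k + 1))‖ / ‖a‖ ^ (k + 1) *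
        (((k + 1 : ℕ) : ℝ) * (‖a‖ + coeffNormSum R) ^ k * coeffNormSum R.eraseLead +
          ((k + 1 : ℕ) : ℝ) * coeffNormSum R ^ k * X₀) := ⟨_, rfl⟩
  rw [← hKD] at hK₀ hDest
  rw [← hCR] at hK₀
  have hKD0 : 0 ≤ KD := by
    rw [hKD]
    have := coeffNormSum_nonneg (D - Polynomial.C (D.coeff (d * (k + 1))) *
      Polynomial.X ^ (d * (k + 1)))
    have := coeffNormSum_nonneg R; have := coeffNormSum_nonneg R.eraseLead
    positivity
  obtain ⟨N₁, hN₁⟩ : ∃ N₁ : ℕ, N₁ = d * (k + 1) := ⟨_, rfl⟩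
  rw [← hN₁] at hDest hΛ ⊢
  obtain ⟨r, hr_def⟩ : ∃ r : ℝ, r = (c * I ^ (k + 1)).re := ⟨_, rfl⟩
  rw [← hr_def] at hΛ
  obtain ⟨β, hβ⟩ : ∃ β : ℝ, β = (D.coeff N₁ * I ^ (k + 1) / a ^ (k + 1)).re := ⟨_, rfl⟩
  rw [← hβ] at hΛ hDest
  set s : ℝ := ‖t‖ with hs_def
  have hs0 : 0 < s := by linarith
  have hN₁' : N₁ = d * k + d := by rw [hN₁]; ring
  have hdk : d * k ≤ N₁ - 1 := by omega
  obtain ⟨w, hw_def⟩ : ∃ w : ℂ, w = R.eval t := ⟨_, rfl⟩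
  rw [← hw_def] at hx hΛ hDest
  have hGeval : (Polynomial.C c * R ^ (k + 2) + D).eval t = c * w ^ (k + 2) + D.eval t := by
    rw [Polynomial.eval_add, Polynomial.eval_mul, Polynomial.eval_C, Polynomial.eval_pow, hw_def]
  rw [hGeval]
  have hwup : ‖w‖ ≤ CR * s ^ d := by
    rw [hw_def, hCR]; exact norm_eval_le_of_natDegree_le R h1 le_rfl le_rfl
  have hwlow : ‖a‖ / 2 * s ^ d ≤ ‖w‖ := by
    have := norm_eval_ge_half_lead R (by omega) h1 (by rw [← ha_def]; exact h2)
    rwa [← ha_def, ← hw_def] at this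
  have hsd : s ≤ s ^ d := le_self_pow₀ h1 (by omega)
  set x : ℝ := w.re with hx_def
  set y : ℝ := w.im with hy_def
  have hxw : |x| ≤ ‖w‖ / 2 := by
    have : X₀ ≤ ‖a‖ / 4 * s := by linarith
    calc |x| ≤ X₀ := hx
      _ ≤ ‖a‖ / 4 * s := this
      _ ≤ ‖a‖ / 4 * s ^ d := mul_le_mul_of_nonneg_left hsd (by positivity)
      _ ≤ ‖w‖ / 2 := by linarith
  have hylow : ‖w‖ / 2 ≤ |y| := by
    have := Complex.norm_le_abs_re_add_abs_im w
    rw [← hx_def, ← hy_def] at this; linarith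
  have hy4 : ‖a‖ / 4 * s ^ d ≤ |y| := by linarith
  have hwk : ‖w‖ ^ k ≤ CR ^ k * s ^ (N₁ - 1) := by
    calc ‖w‖ ^ k ≤ (CR * s ^ d) ^ k := pow_le_pow_left₀ (norm_nonneg _) hwup k
      _ = CR ^ k * s ^ (d * k) := by rw [mul_pow, ← pow_mul]
      _ ≤ CR ^ k * s ^ (N₁ - 1) :=
          mul_le_mul_of_nonneg_left (pow_le_pow_right₀ h1 hdk) (by positivity)
  have htaylor := abs_re_mul_pow_sub_taylor_le hph w
  rw [← hx_def, ← hy_def, ← hr_def] at htaylor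
  have hE1 : |(c * w ^ (k + 2)).re - ((k + 2 : ℕ) : ℝ) * x * y ^ (k + 1) * r| ≤
      ‖c‖ * ((k + 2 : ℕ) : ℝ) ^ 2 * CR ^ k * X₀ ^ 2 * s ^ (N₁ - 1) := by
    refine htaylor.trans ?_
    have hx2 : x ^ 2 ≤ X₀ ^ 2 := by
      rw [← sq_abs x]; exact pow_le_pow_left₀ (abs_nonneg x) hx 2
    calc ‖c‖ * ((k + 2 : ℕ) : ℝ) ^ 2 * ‖w‖ ^ k * x ^ 2
        ≤ ‖c‖ * ((k + 2 : ℕ) : ℝ) ^ 2 * (CR ^ k * s ^ (N₁ - 1)) * X₀ ^ 2 := by gcongr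
      _ = ‖c‖ * ((k + 2 : ℕ) : ℝ) ^ 2 * CR ^ k * X₀ ^ 2 * s ^ (N₁ - 1) := by ring
  have hmain_eq : (c * w ^ (k + 2) + D.eval t).re =
      y ^ (k + 1) * (((k + 2 : ℕ) : ℝ) * r * x + β) +
      (((c * w ^ (k + 2)).re - ((k + 2 : ℕ) : ℝ) * x * y ^ (k + 1) * r) +
        ((D.eval t).re - β * y ^ (k + 1))) := by
    rw [Complex.add_re]; ring
  have herr : |((c * w ^ (k + 2)).re - ((k + 2 : ℕ) : ℝ) * x * y ^ (k + 1) * r) +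
      ((D.eval t).re - β * y ^ (k + 1))| ≤ K₀ * s ^ (N₁ - 1) := by
    have e : K₀ * s ^ (N₁ - 1) = ‖c‖ * ((k + 2 : ℕ) : ℝ) ^ 2 * CR ^ k * X₀ ^ 2 * s ^ (N₁ - 1) +
        KD * s ^ (N₁ - 1) := by rw [hK₀]; ring
    rw [e]
    exact (abs_add_le _ _).trans (add_le_add hE1 hDest)
  have hyN : (‖a‖ / 4) ^ (k + 1) * s ^ N₁ ≤ |y| ^ (k + 1) := by
    rw [hN₁, pow_mul, ← mul_pow]; exact pow_le_pow_left₀ (by positivity) hy4 _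
  have herr2 : K₀ * s ^ (N₁ - 1) ≤ η / 2 * ((‖a‖ / 4) ^ (k + 1) * s ^ N₁) := by
    have hsN : s ^ (N₁ - 1) * s = s ^ N₁ := by
      rw [← pow_succ]; congr 1; omega
    calc K₀ * s ^ (N₁ - 1) ≤ (η / 2 * (‖a‖ / 4) ^ (k + 1) * s) * s ^ (N₁ - 1) :=
          mul_le_mul_of_nonneg_right h4 (by positivity)
      _ = η / 2 * ((‖a‖ / 4) ^ (k + 1) * s ^ N₁) := by rw [← hsN]; ring
  have hmain : η * |y| ^ (k + 1) ≤ |y ^ (k + 1) * (((k + 2 : ℕ) : ℝ) * r * x + β)| := by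
    rw [abs_mul, abs_pow, mul_comm]
    exact mul_le_mul_of_nonneg_left hΛ (by positivity)
  rw [hmain_eq]
  have htri := abs_sub_abs_le_abs_sub (y ^ (k + 1) * (((k + 2 : ℕ) : ℝ) * r * x + β))
    (-((((c * w ^ (k + 2)).re - ((k + 2 : ℕ) : ℝ) * x * y ^ (k + 1) * r) +
      ((D.eval t).re - β * y ^ (k + 1)))))
  rw [abs_neg, sub_neg_eq_add] at htri
  have hηy : η * ((‖a‖ / 4) ^ (k + 1) * s ^ N₁) ≤ η * |y| ^ (k + 1) :=
    mul_le_mul_of_nonneg_left hyN hη.le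
  linarith only [htri, hmain, herr, herr2, hηy]

/-- **Growth along a horizontal edge.**  See the module docstring. (new) -/
theorem tendsto_growth_eval_of_flat (R : Polynomial ℂ) (hd : 2 ≤ R.natDegree) (c : ℂ)
    (e : ℕ) (he : 2 ≤ e) (hph : (c * I ^ e).re = 0) (D : Polynomial ℂ)
    (hD : D.natDegree ≤ R.natDegree * (e - 1)) {t : ℕ → ℂ}
    (ht : Tendsto (fun j => ‖t j‖) atTop atTop) {L₀ : ℝ}
    (hlim : Tendsto (fun j => (R.eval (t j)).re) atTop (𝓝 L₀))
    (hΛ : (e : ℝ) * (c * I ^ (e - 1)).re * L₀ +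
      (D.coeff (R.natDegree * (e - 1)) * I ^ (e - 1) / R.leadingCoeff ^ (e - 1)).re ≠ 0) :
    Tendsto (fun j => |((Polynomial.C c * R ^ e + D).eval (t j)).re| /
      Real.log (2 + ‖(Polynomial.C c * R ^ e + D).eval (t j)‖)) atTop atTop := by
  obtain ⟨k, rfl⟩ : ∃ k, e = k + 2 := ⟨e - 2, by omega⟩
  have hk1 : k + 2 - 1 = k + 1 := by omega
  rw [hk1] at hD hΛ
  set d : ℕ := R.natDegree with hd_def
  obtain ⟨G, hG_def⟩ : ∃ G : Polynomial ℂ, G = Polynomial.C c * R ^ (k + 2) + D := ⟨_, rfl⟩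
  rw [← hG_def]
  have hR0 : R ≠ 0 := by rintro rfl; rw [hd_def, Polynomial.natDegree_zero] at hd; omega
  obtain ⟨a, ha_def⟩ : ∃ a : ℂ, a = R.leadingCoeff := ⟨_, rfl⟩
  have ha0 : a ≠ 0 := by rw [ha_def]; exact Polynomial.leadingCoeff_ne_zero.2 hR0
  have hapos : 0 < ‖a‖ := norm_pos_iff.2 ha0
  obtain ⟨Λ, hΛ_def⟩ : ∃ Λ : ℝ, Λ = ((k + 2 : ℕ) : ℝ) * (c * I ^ (k + 1)).re * L₀ +
      (D.coeff (d * (k + 1)) * I ^ (k + 1) / R.leadingCoeff ^ (k + 1)).re := ⟨_, rfl⟩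
  have hΛpos : 0 < |Λ| := abs_pos.2 (by rw [hΛ_def]; exact_mod_cast hΛ)
  set fn : ℕ → ℝ := fun j => ((k + 2 : ℕ) : ℝ) * (c * I ^ (k + 1)).re * (R.eval (t j)).re +
    (D.coeff (d * (k + 1)) * I ^ (k + 1) / R.leadingCoeff ^ (k + 1)).re with hfn
  have hfnlim : Tendsto fn atTop (𝓝 Λ) := by
    rw [hΛ_def]
    exact (hlim.const_mul (((k + 2 : ℕ) : ℝ) * (c * I ^ (k + 1)).re)).add_const
      ((D.coeff (d * (k + 1)) * I ^ (k + 1) / R.leadingCoeff ^ (k + 1)).re)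
  have hEη : ∀ᶠ j in atTop, |Λ| / 2 ≤ |fn j| := by
    have h := hfnlim (Metric.ball_mem_nhds Λ (half_pos hΛpos))
    filter_upwards [h] with j hj
    rw [Set.mem_preimage, Metric.mem_ball, Real.dist_eq] at hj
    have := abs_sub_abs_le_abs_sub Λ (fn j)
    rw [abs_sub_comm] at hj
    linarith
  obtain ⟨X₀, hX₀_def⟩ : ∃ X₀ : ℝ, X₀ = |L₀| + 1 := ⟨_, rfl⟩
  have hX₀0 : 0 ≤ X₀ := by rw [hX₀_def]; positivity
  have hEx : ∀ᶠ j in atTop, |(R.eval (t j)).re| ≤ X₀ := by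
    have h := hlim (Metric.ball_mem_nhds L₀ one_pos)
    filter_upwards [h] with j hj
    rw [Set.mem_preimage, Metric.mem_ball, Real.dist_eq] at hj
    have := abs_sub_abs_le_abs_sub (R.eval (t j)).re L₀
    rw [hX₀_def]; linarith
  obtain ⟨K₀, hK₀⟩ : ∃ K₀ : ℝ, K₀ = ‖c‖ * ((k + 2 : ℕ) : ℝ) ^ 2 * coeffNormSum R ^ k * X₀ ^ 2 +
      (coeffNormSum (D - Polynomial.C (D.coeff (d * (k + 1))) * Polynomial.X ^ (d * (k + 1))) +
      ‖D.coeff (d * (k + 1))‖ / ‖R.leadingCoeff‖ ^ (k + 1) *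
        (((k + 1 : ℕ) : ℝ) * (‖R.leadingCoeff‖ + coeffNormSum R) ^ k * coeffNormSum R.eraseLead +
          ((k + 1 : ℕ) : ℝ) * coeffNormSum R ^ k * X₀)) := ⟨_, rfl⟩
  obtain ⟨N, hN⟩ : ∃ N : ℕ, N = G.natDegree + 2 := ⟨_, rfl⟩
  have hNpos : (0 : ℝ) < (N : ℝ) := by rw [hN]; positivity
  obtain ⟨Kstar, hKstar_def⟩ : ∃ Kstar : ℝ,
    Kstar = |Λ| / 2 / 2 * (‖a‖ / 4) ^ (k + 1) / (2 * (N : ℝ)) := ⟨_, rfl⟩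
  have hKstar : 0 < Kstar := by rw [hKstar_def]; positivity
  have hlog : Tendsto (fun j => Real.log ‖t j‖) atTop atTop := Real.tendsto_log_atTop.comp ht
  have hE1 : ∀ᶠ j in atTop, 1 ≤ ‖t j‖ := ht.eventually_ge_atTop 1
  have hE2 : ∀ᶠ j in atTop, 2 * coeffNormSum R.eraseLead / ‖a‖ ≤ ‖t j‖ := ht.eventually_ge_atTop _
  have hE3 : ∀ᶠ j in atTop, 4 * X₀ / ‖a‖ ≤ ‖t j‖ := ht.eventually_ge_atTop _
  have hE4 : ∀ᶠ j in atTop, K₀ / (|Λ| / 2 / 2 * (‖a‖ / 4) ^ (k + 1)) ≤ ‖t j‖ :=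
    ht.eventually_ge_atTop _
  have hE5 : ∀ᶠ j in atTop, Real.log (2 + (coeffNormSum G + 1)) ≤ Real.log ‖t j‖ :=
    hlog.eventually_ge_atTop _
  have hE6 : ∀ᶠ j in atTop, 3 ≤ ‖t j‖ := ht.eventually_ge_atTop 3
  have hcmp : Tendsto (fun j => Kstar * ‖t j‖) atTop atTop := ht.const_mul_atTop hKstar
  refine tendsto_atTop_mono' atTop ?_ hcmp
  filter_upwards [hE1, hE2, hE3, hE4, hE5, hE6, hEη, hEx] with j h1 h2 h3 h4 h5 h6 hη hxj
  have h2' : 2 * coeffNormSum R.eraseLead ≤ ‖R.leadingCoeff‖ * ‖t j‖ := by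
    rw [div_le_iff₀ hapos] at h2; rw [← ha_def]; linarith only [h2]
  have h3' : 4 * X₀ ≤ ‖R.leadingCoeff‖ * ‖t j‖ := by
    rw [div_le_iff₀ hapos] at h3; rw [← ha_def]; linarith only [h3]
  have hηpos : 0 < |Λ| / 2 := by positivity
  have h4' : K₀ ≤ |Λ| / 2 / 2 * (‖R.leadingCoeff‖ / 4) ^ (k + 1) * ‖t j‖ := by
    rw [div_le_iff₀ (by positivity : (0 : ℝ) < |Λ| / 2 / 2 * (‖a‖ / 4) ^ (k + 1))] at h4
    rw [← ha_def]; linarith only [h4]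
  have hlow := flat_re_lower_bound R hd c hph D hD hX₀0 hηpos hxj hη h1 h2' h3' hK₀ h4'
  rw [← ha_def, ← hG_def] at hlow
  have hlogG := log_two_add_norm_eval_le G h1 h5
  rw [← hN] at hlogG
  have hlogGpos : 0 < Real.log (2 + ‖G.eval (t j)‖) :=
    Real.log_pos (by linarith only [norm_nonneg (G.eval (t j))])
  have hlogspos : 0 < Real.log ‖t j‖ := Real.log_pos (by linarith only [h6])
  set s : ℝ := ‖t j‖ with hs_def
  have hs0 : 0 < s := by linarith only [h6]
  have hlogle : Real.log s ≤ s := (Real.log_le_sub_one_of_pos hs0).trans (by linarith only [h6])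
  have hN₁2 : 2 ≤ d * (k + 1) := le_trans hd (Nat.le_mul_of_pos_right _ (Nat.succ_pos k))
  have hslog : Real.log s * s ≤ s ^ (d * (k + 1)) := by
    calc Real.log s * s ≤ s * s := mul_le_mul_of_nonneg_right hlogle hs0.le
      _ = s ^ 2 := (sq s).symm
      _ ≤ s ^ (d * (k + 1)) := pow_le_pow_right₀ h1 hN₁2
  obtain ⟨Kc, hKc⟩ : ∃ Kc : ℝ, Kc = |Λ| / 2 / 2 * (‖a‖ / 4) ^ (k + 1) := ⟨_, rfl⟩
  have hKc0 : 0 ≤ Kc := by rw [hKc]; positivity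
  rw [← hKc] at hlow
  have hKstar' : Kstar = Kc / (2 * (N : ℝ)) := by rw [hKstar_def, hKc]
  calc Kstar * s = Kc / (2 * (N : ℝ)) * s := by rw [hKstar']
    _ ≤ Kc / (2 * (N : ℝ)) * (s ^ (d * (k + 1)) / Real.log s) := by
        refine mul_le_mul_of_nonneg_left ?_ (by positivity)
        rw [le_div_iff₀ hlogspos, mul_comm]; exact hslog
    _ = Kc * s ^ (d * (k + 1)) / (2 * (N : ℝ) * Real.log s) := by
        field_simp
    _ ≤ |(G.eval (t j)).re| / (2 * (N : ℝ) * Real.log s) :=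
        div_le_div_of_nonneg_right hlow (by positivity)
    _ ≤ |(G.eval (t j)).re| / Real.log (2 + ‖G.eval (t j)‖) :=
        div_le_div_of_nonneg_left (abs_nonneg _) hlogGpos hlogG

end Summit.Schanuel.Schanuel.Theorems
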